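import Summits.Ventures.LatticeQCDFlow.Scoring.BesselToeplitzAndreief
import HarnessLib

/-!
# The `SU(N)` eigen-angle integral for EVERY `N`: `∫ Π_b e^{x cos φ_b} |Δ(e^{iφ})|² dθ = (2π)^{N−1} N! Σ_q det[I_{|i−j−q|}(x)]`

HONEST FRAMING: exact (Metropolis-corrected) sampling algorithms for lattice gauge theory;
figures of merit are autocorrelation/cost numbers at stated couplings and volumes; no
continuum-physics claim.

Venture `LatticeQCDFlow` (cell pub-lqcd), sub-topic `Scoring`; FANOUT row 5 (`s0-sun-a`), GEN-17.
NEW WORK of the cell (placement rule).  Part 1 of the `SU(N)` one-plaquette law for EVERY `N`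
(generalising GEN-16's `SU(3)` Bars–Green series `Z₃ = 6(2π)² Σ_q det[I_{|q+i−j|}]_{3×3}` and GEN-9's
`SU(2)`): the eigen-angle side.  On the maximal torus `SΔ(n)` of `SU(n)` one eigen-phase is dependent:
fixing an index `i₀`, the free phases are `θ : {i // i ≠ i₀} → ℝ` and the full phase vector is
`φ_b = θ_b (b ≠ i₀)`, `φ_{i₀} = −Σ_j θ_j` (written out as `if h : b = i₀ then −Σθ else θ_b`; no `def`).

* §1 bookkeeping: products over `n` split into the `i₀` factor and the free factors; continuity of `φ_b`;
* §2 **the twisted one-plaquette integral over the free phases**: for every `m : n → ℤ`,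
  `∫_{(−π,π]^{n∖i₀}} Π_b e^{x cos φ_b} e^{i m_b φ_b} dθ = (2π)^{N−1} Σ_{q∈ℤ} Π_b I_{|m_b − q|}(x)`
  — ONLY the dependent weight `e^{x cos φ_{i₀}}` is expanded in its Bessel generating series
  (`Σ_p I_{|p|} e^{ipφ_{i₀}}`, `φ_{i₀} = −Σθ`), after which the integrand factorises over the free phases and
  part 1's Fourier coefficients `∫ e^{x cos θ} e^{ikθ} = 2π I_{|k|}(x)` apply coordinate by coordinate;
* §3 **the weighted Vandermonde integral on `SΔ(n)`**: with `|Δ(φ)|² = Σ_{σ,τ} sgn σ sgn τ Π_b e^{i(ν_σ b − ν_τ b)φ_b}`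
  (the tree's `WeylIntegration.norm_vdm_sq_eq_sum`) and part 1's Andréief identity, for every real `x`,
  `∫ (Π_b e^{x cos φ_b}) |Δ(φ)|² dθ = (2π)^{N−1} · N! · Σ_{q∈ℤ} det[I_{|i−j−q|}(x)]_{i,j}` (complex form;
  entries indexed by `n` through `enum n`).

Part 2 (`SUNOnePlaquetteBesselSeries.lean`) takes the real form and moves it to the Haar measure of `SU(n)`
with the tree's Weyl integral formula for `SU(n)` and row 10's circle chart of `SΔ(n)`.  No `def`, nothing
cited as a fact, 0 sorry.
-/

noncomputable section

open Real MeasureTheory Finset Complex Equiv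
open scoped ENNReal
open Literature.Analysis.FunctionSpaces
open Literature.RepresentationTheory.CompactGroups.WeylIntegration

namespace Summit.Ventures.LatticeQCDFlow.Scoring

variable {n : Type*} [Fintype n] [DecidableEq n] (i₀ : n)

/-! ### 1. Splitting products over `n` at the dependent index `i₀`; continuity of the phases -/

/-- **Splitting a product over `n` at `i₀`**: `Π_b g_b(φ_b) = g_{i₀}(−Σθ) · Π_{j ≠ i₀} g_j(θ_j)`. -/
theorem prod_ext_eq_mul_prod {M : Type*} [CommMonoid M] (g : n → ℝ → M) (θ : {i : n // i ≠ i₀} → ℝ) :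
    ∏ b, g b (if h : b = i₀ then -∑ k, θ k else θ ⟨b, h⟩)
      = g i₀ (-∑ k, θ k) * ∏ j : {i : n // i ≠ i₀}, g j (θ j) := by
  rw [← Finset.mul_prod_erase _ _ (Finset.mem_univ i₀), dif_pos rfl]
  congr 1
  rw [Finset.prod_subtype (Finset.univ.erase i₀) (p := fun i => i ≠ i₀) (fun i => by simp)]
  refine Finset.prod_congr rfl fun j _ => ?_
  rw [dif_neg j.2]

/-- Splitting a product over `n` at `i₀` for a function of the index only. -/
theorem prod_eq_mul_prod_subtype {M : Type*} [CommMonoid M] (g : n → M) :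
    ∏ b, g b = g i₀ * ∏ j : {i : n // i ≠ i₀}, g j := by
  rw [← Finset.mul_prod_erase _ _ (Finset.mem_univ i₀)]
  congr 1
  exact Finset.prod_subtype (Finset.univ.erase i₀) (p := fun i => i ≠ i₀) (fun i => by simp) g

/-- Each full phase `φ_b` is a continuous function of the free phases. -/
theorem continuous_ext_apply (b : n) :
    Continuous fun θ : {i : n // i ≠ i₀} → ℝ => (if h : b = i₀ then -∑ k, θ k else θ ⟨b, h⟩ : ℝ) := by
  by_cases hb : b = i₀
  · simp only [hb, dite_true]
    fun_prop
  · simp only [hb, dite_false]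
    fun_prop

/-! ### 2. The twisted one-plaquette integral over the free eigen-phases -/

omit [DecidableEq n] in
/-- `I_{|k|}(|y|) ≤ e^{|y|}`: one term of the generating function `Σ_m I_{|m|}(|y|) = e^{|y|}`, all terms `≥ 0`. -/
theorem besselI_natAbs_abs_le_exp (k : ℤ) (y : ℝ) : besselI k.natAbs |y| ≤ Real.exp |y| :=
  le_hasSum (hasSum_besselI_natAbs |y|) k fun _ _ => besselI_nonneg _ (abs_nonneg y)

omit [DecidableEq n] in
/-- The norm of one twisted weight factor: `‖e^{x cos t} e^{ikt}‖ ≤ e^{|x|}` (`k` any complex-cast integer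
expression enters only through `‖e^{i·real}‖ = 1`). -/
theorem norm_cexp_cos_mul_cexp_le (x t : ℝ) (k : ℤ) :
    ‖cexp ((x : ℂ) * Real.cos t) * cexp ((k : ℂ) * t * I)‖ ≤ Real.exp |x| := by
  rw [norm_mul, show (k : ℂ) * (t : ℂ) * I = (((k : ℝ) * t : ℝ) : ℂ) * I by push_cast; ring,
    Complex.norm_exp_ofReal_mul_I, mul_one, show (x : ℂ) * (Real.cos t : ℂ) = ((x * Real.cos t : ℝ) : ℂ) by
      push_cast; ring, Complex.norm_exp_ofReal, Real.exp_le_exp]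
  calc x * Real.cos t ≤ |x * Real.cos t| := le_abs_self _
    _ = |x| * |Real.cos t| := abs_mul _ _
    _ ≤ |x| * 1 := mul_le_mul_of_nonneg_left (Real.abs_cos_le_one _) (abs_nonneg _)
    _ = |x| := mul_one _

/-- **The dependent factor in its Bessel generating series, spread over the free phases**:
`e^{x cos(−Σθ)} e^{i m (−Σθ)} = Σ_p I_{|p|}(x) Π_j e^{−i(p+m)θ_j}` (`HasSum`). -/
theorem hasSum_dependent_factor (x : ℝ) (m : ℤ) (θ : {i : n // i ≠ i₀} → ℝ) :
    HasSum (fun p : ℤ => (besselI p.natAbs x : ℂ) *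
        ∏ j : {i : n // i ≠ i₀}, cexp (-((p + m : ℤ) : ℂ) * θ j * I))
      (cexp ((x : ℂ) * Real.cos (-∑ k, θ k)) * cexp ((m : ℂ) * ((-∑ k, θ k : ℝ) : ℂ) * I)) := by
  have h := (hasSum_besselI_natAbs_mul_cexp x (-∑ k, θ k)).mul_right
    (cexp ((m : ℂ) * ((-∑ k, θ k : ℝ) : ℂ) * I))
  refine h.congr_fun fun p => ?_
  rw [mul_assoc, ← Complex.exp_add, ← Complex.exp_sum]
  congr 2
  rw [← Finset.sum_mul, ← Finset.mul_sum]
  push_cast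
  ring

/-- **THE TWISTED ONE-PLAQUETTE INTEGRAL OVER THE FREE PHASES**: for every `m : n → ℤ` and real `x`,
`∫_{(−π,π]^{n∖i₀}} Π_b e^{x cos φ_b} e^{i m_b φ_b} dθ = (2π)^{N−1} Σ_{q∈ℤ} Π_b I_{|m_b − q|}(x)`.
Only the dependent weight is expanded; the rest is Fubini and the one-angle Fourier coefficients `2π I_{|k|}(x)`. -/
theorem integral_cube_prod_cexp_cos_mul_cexp_ext (x : ℝ) (m : n → ℤ) :
    ∫ θ, ∏ b, (cexp ((x : ℂ) * Real.cos (if h : b = i₀ then -∑ k, θ k else θ ⟨b, h⟩)) *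
        cexp ((m b : ℂ) * ((if h : b = i₀ then -∑ k, θ k else θ ⟨b, h⟩ : ℝ) : ℂ) * I))
        ∂(Measure.pi fun _ : {i : n // i ≠ i₀} => (volume : Measure ℝ).restrict (Set.Ioc (-π) π))
      = (2 * π : ℂ) ^ Fintype.card {i : n // i ≠ i₀} *
          ∑' q : ℤ, ∏ b, (besselI (m b - q).natAbs x : ℂ) := by
  set μ : Measure ({i : n // i ≠ i₀} → ℝ) :=
    Measure.pi fun _ : {i : n // i ≠ i₀} => (volume : Measure ℝ).restrict (Set.Ioc (-π) π) with hμ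
  haveI : IsFiniteMeasure μ := by rw [hμ]; infer_instance
  -- the terms after expanding the dependent weight
  set F : ℤ → ({i : n // i ≠ i₀} → ℝ) → ℂ := fun p θ => (besselI p.natAbs x : ℂ) *
    ∏ j : {i : n // i ≠ i₀}, (cexp ((x : ℂ) * Real.cos (θ j)) * cexp (((m j - p - m i₀ : ℤ) : ℂ) * θ j * I))
    with hF
  have hFeq : ∀ θ : {i : n // i ≠ i₀} → ℝ,
      ∏ b, (cexp ((x : ℂ) * Real.cos (if h : b = i₀ then -∑ k, θ k else θ ⟨b, h⟩)) *
        cexp ((m b : ℂ) * ((if h : b = i₀ then -∑ k, θ k else θ ⟨b, h⟩ : ℝ) : ℂ) * I))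
        = ∑' p, F p θ := by
    intro θ
    rw [prod_ext_eq_mul_prod i₀ (fun b t => cexp ((x : ℂ) * Real.cos t) * cexp ((m b : ℂ) * (t : ℂ) * I)) θ,
      ← (hasSum_dependent_factor i₀ x (m i₀) θ).tsum_eq, ← tsum_mul_right]
    refine tsum_congr fun p => ?_
    simp only [hF]
    rw [mul_assoc, ← Finset.prod_mul_distrib]
    congr 1
    refine Finset.prod_congr rfl fun j _ => ?_
    rw [mul_left_comm, ← Complex.exp_add]
    congr 2
    push_cast
    ring
  have hFnorm : ∀ p θ, ‖F p θ‖ ≤ besselI p.natAbs |x| * Real.exp |x| ^ Fintype.card {i : n // i ≠ i₀} := by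
    intro p θ
    simp only [hF]
    rw [norm_mul, Complex.norm_real, Real.norm_eq_abs, abs_besselI_eq_besselI_abs, norm_prod]
    refine mul_le_mul_of_nonneg_left ?_ (besselI_nonneg _ (abs_nonneg x))
    rw [← Finset.card_univ, ← Finset.prod_const]
    exact Finset.prod_le_prod (fun j _ => norm_nonneg _) fun j _ => norm_cexp_cos_mul_cexp_le x (θ j) _
  have hFint : ∀ p, Integrable (F p) μ := by
    intro p
    refine Integrable.mono' (integrable_const (besselI p.natAbs |x| * Real.exp |x| ^ Fintype.card {i : n // i ≠ i₀}))
      ?_ (Filter.Eventually.of_forall fun θ => hFnorm p θ)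
    simp only [hF]
    exact (continuous_const.mul (continuous_finsetProd _ fun j _ => by fun_prop)).aestronglyMeasurable
  have hFsum : Summable fun p => ∫ θ, ‖F p θ‖ ∂μ := by
    refine Summable.of_nonneg_of_le (fun p => integral_nonneg fun θ => norm_nonneg _)
      (fun p => ?_) (((summable_besselI_natAbs |x|).mul_right
        (Real.exp |x| ^ Fintype.card {i : n // i ≠ i₀} * μ.real Set.univ)))
    calc ∫ θ, ‖F p θ‖ ∂μ ≤ ∫ _θ, besselI p.natAbs |x| * Real.exp |x| ^ Fintype.card {i : n // i ≠ i₀} ∂μ :=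
          integral_mono_of_nonneg (Filter.Eventually.of_forall fun θ => norm_nonneg _) (integrable_const _)
            (Filter.Eventually.of_forall fun θ => hFnorm p θ)
      _ = besselI p.natAbs |x| * (Real.exp |x| ^ Fintype.card {i : n // i ≠ i₀} * μ.real Set.univ) := by
          rw [integral_const, smul_eq_mul]; ring
  -- each term integrates by Fubini and the one-angle Fourier coefficients
  have hI : ∀ p : ℤ, ∫ θ, F p θ ∂μ = (besselI p.natAbs x : ℂ) * ((2 * π : ℂ) ^ Fintype.card {i : n // i ≠ i₀} *
      ∏ j : {i : n // i ≠ i₀}, (besselI (m j - p - m i₀).natAbs x : ℂ)) := by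
    intro p
    simp only [hF]
    rw [integral_const_mul, hμ, integral_fintype_prod_eq_prod (𝕜 := ℂ)
      (fun (j : {i : n // i ≠ i₀}) (t : ℝ) => cexp ((x : ℂ) * Real.cos t) * cexp (((m j - p - m i₀ : ℤ) : ℂ) * t * I))]
    simp_rw [integral_Ioc_cexp_mul_cos_mul_cexp_int]
    rw [Finset.prod_mul_distrib, Finset.prod_const, Finset.card_univ]
  calc ∫ θ, ∏ b, (cexp ((x : ℂ) * Real.cos (if h : b = i₀ then -∑ k, θ k else θ ⟨b, h⟩)) *
        cexp ((m b : ℂ) * ((if h : b = i₀ then -∑ k, θ k else θ ⟨b, h⟩ : ℝ) : ℂ) * I)) ∂μ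
      = ∫ θ, ∑' p, F p θ ∂μ := integral_congr_ae (Filter.Eventually.of_forall hFeq)
    _ = ∑' p, ∫ θ, F p θ ∂μ := (integral_tsum_of_summable_integral_norm hFint hFsum).symm
    _ = ∑' p : ℤ, (2 * π : ℂ) ^ Fintype.card {i : n // i ≠ i₀} * ((besselI p.natAbs x : ℂ) *
          ∏ j : {i : n // i ≠ i₀}, (besselI (m j - p - m i₀).natAbs x : ℂ)) := by
        refine tsum_congr fun p => ?_
        rw [hI]; ring
    _ = (2 * π : ℂ) ^ Fintype.card {i : n // i ≠ i₀} * ∑' p : ℤ, ((besselI p.natAbs x : ℂ) *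
          ∏ j : {i : n // i ≠ i₀}, (besselI (m j - p - m i₀).natAbs x : ℂ)) := tsum_mul_left
    _ = (2 * π : ℂ) ^ Fintype.card {i : n // i ≠ i₀} * ∑' q : ℤ, ∏ b, (besselI (m b - q).natAbs x : ℂ) := by
        congr 1
        calc ∑' p : ℤ, ((besselI p.natAbs x : ℂ) *
              ∏ j : {i : n // i ≠ i₀}, (besselI (m j - p - m i₀).natAbs x : ℂ))
            = ∑' q : ℤ, ((besselI (Equiv.subRight (m i₀) q).natAbs x : ℂ) *
                ∏ j : {i : n // i ≠ i₀}, (besselI (m j - Equiv.subRight (m i₀) q - m i₀).natAbs x : ℂ)) :=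
              ((Equiv.subRight (m i₀)).tsum_eq (fun p : ℤ => (besselI p.natAbs x : ℂ) *
                ∏ j : {i : n // i ≠ i₀}, (besselI (m j - p - m i₀).natAbs x : ℂ))).symm
          _ = ∑' q : ℤ, ∏ b, (besselI (m b - q).natAbs x : ℂ) := by
              refine tsum_congr fun q => ?_
              rw [Equiv.subRight_apply, prod_eq_mul_prod_subtype i₀ (fun b => (besselI (m b - q).natAbs x : ℂ))]
              congr 1
              · rw [show (q - m i₀).natAbs = (m i₀ - q).natAbs by omega]
              · refine Finset.prod_congr rfl fun j _ => ?_
                rw [show m j - (q - m i₀) - m i₀ = m j - q by ring]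

/-! ### 3. The weighted Vandermonde integral over the free eigen-phases -/

/-- The `q`-series of Bessel products is absolutely summable. -/
theorem summable_norm_prod_besselI_sub (i₀ : n) (x : ℝ) (m : n → ℤ) :
    Summable fun q : ℤ => ‖∏ b, (besselI (m b - q).natAbs x : ℂ)‖ := by
  refine Summable.of_nonneg_of_le (fun q => norm_nonneg _) (fun q => ?_)
    ((((summable_besselI_natAbs |x|).comp_injective (Equiv.subLeft (m i₀)).injective)).mul_right
      (Real.exp |x| ^ Fintype.card {i : n // i ≠ i₀}))
  rw [prod_eq_mul_prod_subtype i₀, norm_mul, Complex.norm_real, Real.norm_eq_abs, abs_besselI_eq_besselI_abs,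
    norm_prod, Function.comp_apply, Equiv.subLeft_apply]
  refine mul_le_mul_of_nonneg_left ?_ (besselI_nonneg _ (abs_nonneg x))
  rw [← Finset.card_univ, ← Finset.prod_const]
  refine Finset.prod_le_prod (fun j _ => norm_nonneg _) fun j _ => ?_
  rw [Complex.norm_real, Real.norm_eq_abs, abs_besselI_eq_besselI_abs]
  exact besselI_natAbs_abs_le_exp _ _

/-- Each term of the Leibniz double expansion, weighted, is integrable on the free cube. -/
theorem integrable_cube_weighted_term_ext (x : ℝ) (σ τ : Perm n) :
    Integrable (fun θ : {i : n // i ≠ i₀} → ℝ => ((Equiv.Perm.sign σ : ℤ) : ℂ) * ((Equiv.Perm.sign τ : ℤ) : ℂ) *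
        ∏ b, (cexp ((x : ℂ) * Real.cos (if h : b = i₀ then -∑ k, θ k else θ ⟨b, h⟩)) *
          cexp ((charVec σ b - charVec τ b : ℤ) *
            ((if h : b = i₀ then -∑ k, θ k else θ ⟨b, h⟩ : ℝ) : ℂ) * I)))
      (Measure.pi fun _ : {i : n // i ≠ i₀} => (volume : Measure ℝ).restrict (Set.Ioc (-π) π)) := by
  refine Integrable.const_mul ?_ _
  refine Integrable.mono' (integrable_const ((Real.exp |x|) ^ Fintype.card n)) ?_
    (Filter.Eventually.of_forall fun θ => ?_)
  · refine Continuous.aestronglyMeasurable (continuous_finsetProd _ fun b _ => ?_)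
    have hc := continuous_ext_apply i₀ b
    exact ((continuous_const.mul (Complex.continuous_ofReal.comp (Real.continuous_cos.comp hc))).cexp).mul
      (((continuous_const.mul (Complex.continuous_ofReal.comp hc)).mul continuous_const).cexp)
  · rw [norm_prod, ← Finset.card_univ, ← Finset.prod_const]
    exact Finset.prod_le_prod (fun b _ => norm_nonneg _) fun b _ => norm_cexp_cos_mul_cexp_le x _ _

/-- **THE WEIGHTED VANDERMONDE INTEGRAL ON `SΔ(n)`** (complex form): for every real `x`,
`∫_{(−π,π]^{n∖i₀}} (Π_b e^{x cos φ_b}) |Δ(φ)|² dθ = (2π)^{N−1} · N! · Σ_{q∈ℤ} det[I_{|i−j−q|}(x)]_{i,j}`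
(entries indexed through `enum n`). -/
theorem integral_cube_prod_cexp_cos_mul_norm_vdm_sq_ext (x : ℝ) :
    ∫ θ, (∏ b, cexp ((x : ℂ) * Real.cos (if h : b = i₀ then -∑ k, θ k else θ ⟨b, h⟩))) *
        ((‖vdm (fun i : n => if h : i = i₀ then -∑ k, θ k else θ ⟨i, h⟩)‖ ^ 2 : ℝ) : ℂ)
        ∂(Measure.pi fun _ : {i : n // i ≠ i₀} => (volume : Measure ℝ).restrict (Set.Ioc (-π) π))
      = (2 * π : ℂ) ^ Fintype.card {i : n // i ≠ i₀} * (Fintype.card n).factorial *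
          ∑' q : ℤ, (Matrix.of fun i j : n =>
            (besselI (((enum n i : ℕ) : ℤ) - ((enum n j : ℕ) : ℤ) - q).natAbs x : ℂ)).det := by
  -- expand `|Δ|²` and distribute the weight over the double Leibniz sum
  have hexp : ∀ θ : {i : n // i ≠ i₀} → ℝ,
      (∏ b, cexp ((x : ℂ) * Real.cos (if h : b = i₀ then -∑ k, θ k else θ ⟨b, h⟩))) *
        ((‖vdm (fun i : n => if h : i = i₀ then -∑ k, θ k else θ ⟨i, h⟩)‖ ^ 2 : ℝ) : ℂ)
      = ∑ σ : Perm n, ∑ τ : Perm n, ((Equiv.Perm.sign σ : ℤ) : ℂ) * ((Equiv.Perm.sign τ : ℤ) : ℂ) *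
          ∏ b, (cexp ((x : ℂ) * Real.cos (if h : b = i₀ then -∑ k, θ k else θ ⟨b, h⟩)) *
            cexp ((charVec σ b - charVec τ b : ℤ) *
              ((if h : b = i₀ then -∑ k, θ k else θ ⟨b, h⟩ : ℝ) : ℂ) * I)) := by
    intro θ
    rw [norm_vdm_sq_eq_sum, Finset.mul_sum]
    refine Finset.sum_congr rfl fun σ _ => ?_
    rw [Finset.mul_sum]
    refine Finset.sum_congr rfl fun τ _ => ?_
    rw [Finset.prod_mul_distrib]
    ring
  simp_rw [hexp]
  rw [integral_finsetSum _ (fun σ _ => integrable_finsetSum _ fun τ _ => integrable_cube_weighted_term_ext i₀ x σ τ)]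
  simp_rw [integral_finsetSum _ (fun τ _ => integrable_cube_weighted_term_ext i₀ x _ τ), integral_const_mul]
  -- the twisted integrals, term by term
  have hI : ∀ σ τ : Perm n,
      ∫ θ, ∏ b, (cexp ((x : ℂ) * Real.cos (if h : b = i₀ then -∑ k, θ k else θ ⟨b, h⟩)) *
            cexp ((charVec σ b - charVec τ b : ℤ) *
              ((if h : b = i₀ then -∑ k, θ k else θ ⟨b, h⟩ : ℝ) : ℂ) * I))
        ∂(Measure.pi fun _ : {i : n // i ≠ i₀} => (volume : Measure ℝ).restrict (Set.Ioc (-π) π))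
      = (2 * π : ℂ) ^ Fintype.card {i : n // i ≠ i₀} *
          ∑' q : ℤ, ∏ b, (besselI ((((enum n (σ.symm b) : ℕ) : ℤ) - ((enum n (τ.symm b) : ℕ) : ℤ)) - q).natAbs x : ℂ) :=
    fun σ τ => integral_cube_prod_cexp_cos_mul_cexp_ext i₀ x (fun b => charVec σ b - charVec τ b)
  simp_rw [hI]
  have hsum : ∀ σ τ : Perm n, Summable fun q : ℤ => ((Equiv.Perm.sign σ : ℤ) : ℂ) * ((Equiv.Perm.sign τ : ℤ) : ℂ) *
      ∏ b, (besselI ((((enum n (σ.symm b) : ℕ) : ℤ) - ((enum n (τ.symm b) : ℕ) : ℤ)) - q).natAbs x : ℂ) :=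
    fun σ τ => ((summable_norm_prod_besselI_sub i₀ x _).of_norm).mul_left _
  have hterm : ∀ σ τ : Perm n, ((Equiv.Perm.sign σ : ℤ) : ℂ) * ((Equiv.Perm.sign τ : ℤ) : ℂ) *
      ((2 * π : ℂ) ^ Fintype.card {i : n // i ≠ i₀} *
        ∑' q : ℤ, ∏ b, (besselI ((((enum n (σ.symm b) : ℕ) : ℤ) - ((enum n (τ.symm b) : ℕ) : ℤ)) - q).natAbs x : ℂ))
      = (2 * π : ℂ) ^ Fintype.card {i : n // i ≠ i₀} *
        ∑' q : ℤ, (((Equiv.Perm.sign σ : ℤ) : ℂ) * ((Equiv.Perm.sign τ : ℤ) : ℂ) *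
          ∏ b, (besselI ((((enum n (σ.symm b) : ℕ) : ℤ) - ((enum n (τ.symm b) : ℕ) : ℤ)) - q).natAbs x : ℂ)) := by
    intro σ τ
    rw [tsum_mul_left]
    ring
  simp_rw [hterm]
  simp only [← Finset.mul_sum]
  rw [mul_assoc]
  congr 1
  symm
  calc ((Fintype.card n).factorial : ℂ) * ∑' q : ℤ, (Matrix.of fun i j : n =>
          (besselI (((enum n i : ℕ) : ℤ) - ((enum n j : ℕ) : ℤ) - q).natAbs x : ℂ)).det
      = ∑' q : ℤ, ((Fintype.card n).factorial : ℂ) * (Matrix.of fun i j : n =>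
          (besselI (((enum n i : ℕ) : ℤ) - ((enum n j : ℕ) : ℤ) - q).natAbs x : ℂ)).det := tsum_mul_left.symm
    _ = ∑' q : ℤ, ∑ σ : Perm n, ∑ τ : Perm n, ((Equiv.Perm.sign σ : ℤ) : ℂ) * ((Equiv.Perm.sign τ : ℤ) : ℂ) *
          ∏ b, (besselI ((((enum n (σ.symm b) : ℕ) : ℤ) - ((enum n (τ.symm b) : ℕ) : ℤ)) - q).natAbs x : ℂ) := by
        refine tsum_congr fun q => ?_
        rw [← sum_sum_sign_mul_sign_mul_prod_eq_factorial_mul_det]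
        rfl
    _ = ∑ σ : Perm n, ∑' q : ℤ, ∑ τ : Perm n, ((Equiv.Perm.sign σ : ℤ) : ℂ) * ((Equiv.Perm.sign τ : ℤ) : ℂ) *
          ∏ b, (besselI ((((enum n (σ.symm b) : ℕ) : ℤ) - ((enum n (τ.symm b) : ℕ) : ℤ)) - q).natAbs x : ℂ) :=
        Summable.tsum_finsetSum fun σ _ => summable_sum fun τ _ => hsum σ τ
    _ = ∑ σ : Perm n, ∑ τ : Perm n, ∑' q : ℤ, ((Equiv.Perm.sign σ : ℤ) : ℂ) * ((Equiv.Perm.sign τ : ℤ) : ℂ) *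
          ∏ b, (besselI ((((enum n (σ.symm b) : ℕ) : ℤ) - ((enum n (τ.symm b) : ℕ) : ℤ)) - q).natAbs x : ℂ) :=
        Finset.sum_congr rfl fun σ _ => Summable.tsum_finsetSum fun τ _ => hsum σ τ

end Summit.Ventures.LatticeQCDFlow.Scoring
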